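import Mathlib
import Summits.NavierStokesRegularity.NavierStokesRegularity.Theorems.EulerZoomLiouvillePowerGaugeEulerLiouvilleDriftClockScale
import Summits.NavierStokesRegularity.NavierStokesRegularity.Theorems.EulerZoomLiouvillePowerGaugeEulerLiouvilleNeedleFastTime
import HarnessLib

/-!
# LINE `last_exit`, STUB LE2a `stub_cofinalReturnerBounded`: «THE LAST-EXIT LEVER» — under no far hovering, a vortical high backward half-orbit that returns to the near ball cofinally is bounded
# (crux `EulerZoomLiouville.PowerGaugeEulerLiouville` = stmt-NavierStokesRegularity-19832, THE ONE STATEMENT `stub_selfSimilarC2Needle`; line `Cruxes/PowerGaugeEulerLiouville/Lines/last_exit.lean` (ns-idea-11 g8), registered stub LE2a)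

Route `EulerZoomLiouville` (NavierStokesRegularity), crux E; width seat ns-ezl-w1 g6 (free hand).  The statement is `Sig.stub_cofinalReturnerBounded` of the line
file with `NoFarHovering` δ-unfolded (the skeleton fills LE2a by `exact LastExit.cofinalReturnerBounded`).  Setting: `C²` classical profile `(V, P′)` at rate
`γ = 1/(2+ρ)`, `0 < ρ ≤ ½`, `W y = γy + V y`, `ℋ = ℋ_{P′}`; NO FAR HOVERING above `h` (floor `w₀ > 0` beyond `R₁`); `Y` a global backward half-orbit
(`Y′ = −W(Y)` on `[0, ∞)`) from a VORTICAL point of `{ℋ > h}`, inside `B(0,R₁)` at arbitrarily late times.  CLAIM: `Y` is bounded.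
PROOF (one excursion suffices).  `ℋ∘Y` is non-decreasing with `ℋ(Y b) − ℋ(Y a) = (1−2γ)∫_a^b ‖W(Y)‖²` (CIV (3.31)); the cofinal returns cap `ℋ∘Y` by
`M = sup_{B̄(0,R₁)} ℋ`, so every ACTION `(1−2γ)∫_a^b‖W(Y)‖²` is `≤ M − h`.  If `Y` were unbounded, pick `t₁` with `‖Y t₁‖ > R₁ + L`, `L = (M−h)/((1−2γ)w₀) + 1`,
then the first later time `τ` with `‖Y τ‖ = R₁`; on `[t₁, τ]` the arc is far, high and vortical, so `‖W(Y)‖ ≥ w₀` and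
`∫‖W(Y)‖² ≥ w₀∫‖Y′‖ ≥ w₀‖Y τ − Y t₁‖ ≥ w₀ L` — an action `> M − h`.

* **`LastExit.cofinalReturnerBounded`** — LE2a, signature verbatim (unfolded).

WHAT THIS IS NOT: not NS, not E — one registered PROVABLE stub of a filed line, `--supports` stmt-19832; the line's faces (`stub_hoverFace` = T-E,
`stub_spikeFace`) stay OPEN; the crux is OPEN; NS regularity is NOT proved; no summit statement is proved by this seat.
[folklore; ConstantinIgnatovaVicol2026Putative §3.4.3 (3.31), §3.5; cf. LaSalle's invariance principle]
-/

noncomputable section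

-- flat `Theorems/<Route><Decl>…` files of one crux share the namespace of the crux (tree convention: `Summit.<S>.<S>.…`)
set_option linter.dupNamespace false

open Set Filter Topology Metric MeasureTheory
open scoped RealInnerProductSpace ENNReal

namespace Summit.NavierStokesRegularity.NavierStokesRegularity.Theorems.PowerGaugeEulerLiouville

open Literature.Analysis Literature.Analysis.FluidPDE

namespace LastExit

open ChannelClock

/-- **LE2a «COFINAL RETURNERS ARE BOUNDED»** (`Sig.stub_cofinalReturnerBounded` of `Lines/last_exit.lean`, `NoFarHovering` unfolded): under no far hovering
above `h`, a global backward half-orbit of `W = γy + V` from a vortical point of `{ℋ > h}` which is in `B(0,R₁)` at arbitrarily late times is bounded.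
[folklore; ConstantinIgnatovaVicol2026Putative §3.4.3 (3.31), §3.5] -/
theorem cofinalReturnerBounded :
    ∀ ρ : ℝ, 0 < ρ → ρ ≤ 1 / 2 →
    ∀ (V : EuclideanSpace ℝ (Fin 3) → EuclideanSpace ℝ (Fin 3)) (P' : EuclideanSpace ℝ (Fin 3) → ℝ), ContDiff ℝ 2 V →
      IsSelfSimilarEulerProfile (1 / (2 + ρ)) 0 V P' →
      ∀ (h w₀ R₁ : ℝ), 0 < w₀ →
        (∀ y : EuclideanSpace ℝ (Fin 3), R₁ ≤ ‖y‖ →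
          h < selfSimilarBernoulli (1 / (2 + ρ)) 0 V P' y → curl V y ≠ 0 →
            w₀ ≤ ‖selfSimilarTransport (1 / (2 + ρ)) 0 V y‖) →
      ∀ Y : ℝ → EuclideanSpace ℝ (Fin 3),
        (∀ t : ℝ, 0 ≤ t → HasDerivAt Y ((-1 : ℝ) • selfSimilarTransport (1 / (2 + ρ)) 0 V (Y t)) t) →
        curl V (Y 0) ≠ 0 →
        h < selfSimilarBernoulli (1 / (2 + ρ)) 0 V P' (Y 0) →
        (∀ S : ℝ, ∃ t : ℝ, S ≤ t ∧ ‖Y t‖ < R₁) →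
          ∃ N : ℝ, ∀ t : ℝ, 0 ≤ t → ‖Y t‖ ≤ N := by
  intro ρ hρ hρh V P' hU2 hprof h w₀ R₁ hw₀ hnohov Y hY hcurl0 hh0 hcof
  set γ : ℝ := 1 / (2 + ρ) with hγdef
  have h2ρ : (0 : ℝ) < 2 + ρ := by linarith
  have hγ2 : γ < 1 / 2 := one_div_lt_one_div_of_lt two_pos (by linarith)
  have h12γ : 0 < 1 - 2 * γ := by linarith
  set W := selfSimilarTransport γ 0 V with hWdef
  set g : ℝ → ℝ := fun t => selfSimilarBernoulli γ 0 V P' (Y t) with hgdef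
  have hWc : Continuous W := by
    have e : W = fun y => γ • (y - 0) + V y := rfl
    rw [e]; exact ((continuous_id.sub continuous_const).const_smul γ).add hU2.continuous
  -- the arc in the `−W` form, and its continuity on `[0, ∞)`
  have hY' : ∀ t : ℝ, 0 ≤ t → HasDerivAt Y (-(W (Y t))) t := by
    intro t ht; have := hY t ht; rwa [neg_one_smul] at this
  have hYc : ∀ a b : ℝ, 0 ≤ a → ContinuousOn Y (Icc a b) :=
    fun a b ha t ht => (hY t (ha.trans ht.1)).continuousAt.continuousWithinAt
  -- ### the action identity and monotonicity of `ℋ ∘ Y`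
  have haction : ∀ a b : ℝ, 0 ≤ a → a ≤ b →
      g b - g a = (1 - 2 * γ) * ∫ t in a..b, ‖W (Y t)‖ ^ 2 := by
    intro a b ha hab
    have hid := NeedleClock.bernoulli_comp_sub_eq_of_Icc hprof (s := (-1 : ℝ)) hab (fun t ht => hY t (ha.trans ht.1))
    rw [hid]; ring
  have hint : ∀ a b : ℝ, 0 ≤ a → a ≤ b → IntervalIntegrable (fun t => ‖W (Y t)‖ ^ 2) volume a b :=
    fun a b ha hab => ((hWc.comp_continuousOn (hYc a b ha)).norm.pow 2).intervalIntegrable_of_Icc hab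
  have hmono : ∀ a b : ℝ, 0 ≤ a → a ≤ b → g a ≤ g b := by
    intro a b ha hab
    have hnn : 0 ≤ ∫ t in a..b, ‖W (Y t)‖ ^ 2 := intervalIntegral.integral_nonneg hab fun t _ => sq_nonneg _
    have := haction a b ha hab
    nlinarith [mul_nonneg h12γ.le hnn]
  -- ### the cap `M` from the cofinal returns
  have hHc : Continuous (selfSimilarBernoulli γ 0 V P') := hprof.contDiff_selfSimilarBernoulli.continuous
  obtain ⟨M, hM⟩ := (isCompact_closedBall (0 : EuclideanSpace ℝ (Fin 3)) R₁).bddAbove_image hHc.continuousOn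
  have hcap : ∀ t : ℝ, 0 ≤ t → g t ≤ M := by
    intro t ht
    obtain ⟨t', htt', hYt'⟩ := hcof t
    have h1 : g t ≤ g t' := hmono t t' ht htt'
    have h2 : g t' ≤ M := hM ⟨Y t', by rw [mem_closedBall, dist_zero_right]; exact hYt'.le, rfl⟩
    exact h1.trans h2
  have hlow : ∀ t : ℝ, 0 ≤ t → h < g t := fun t ht => lt_of_lt_of_le hh0 (hmono 0 t le_rfl ht)
  have hMh : h < M := (hlow 0 le_rfl).trans_le (hcap 0 le_rfl)
  -- every action is at most `M − h`
  have hact_le : ∀ a b : ℝ, 0 ≤ a → a ≤ b → (1 - 2 * γ) * ∫ t in a..b, ‖W (Y t)‖ ^ 2 ≤ M - h := by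
    intro a b ha hab
    rw [← haction a b ha hab]
    linarith [hcap b (ha.trans hab), hlow a ha]
  -- ### one far excursion costs too much
  by_contra hunb
  push Not at hunb
  -- `hunb : ∀ N, ∃ t, 0 ≤ t ∧ N < ‖Y t‖`
  set L : ℝ := (M - h) / ((1 - 2 * γ) * w₀) + 1 with hLdef
  have hden : 0 < (1 - 2 * γ) * w₀ := mul_pos h12γ hw₀
  have hL : (1 - 2 * γ) * w₀ * L = (M - h) + (1 - 2 * γ) * w₀ := by
    rw [hLdef, mul_add, mul_one, mul_div_cancel₀ _ hden.ne']
  obtain ⟨t₁, ht₁, hfar₁⟩ := hunb (R₁ + L)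
  obtain ⟨t₂, ht₁₂, hnear₂⟩ := hcof t₁
  -- first later time at radius `R₁`
  set f : ℝ → ℝ := fun s => -‖Y (t₁ + s)‖ with hfdef
  have hfc : ContinuousOn f (Icc 0 (t₂ - t₁)) := by
    have hc : ContinuousOn (fun s => Y (t₁ + s)) (Icc 0 (t₂ - t₁)) := by
      refine (hYc t₁ t₂ ht₁).comp (continuous_const.add continuous_id).continuousOn fun s hs => ?_
      exact ⟨by linarith [hs.1], by linarith [hs.2]⟩
    exact hc.norm.neg
  have hLpos : 0 < L := by
    have : 0 ≤ (M - h) / ((1 - 2 * γ) * w₀) := div_nonneg (by linarith) hden.le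
    linarith
  have hf0 : f 0 < -R₁ := by simp only [hfdef, add_zero]; linarith
  have hf1 : -R₁ ≤ f (t₂ - t₁) := by
    simp only [hfdef, add_sub_cancel]; linarith
  obtain ⟨σ₁, hσ₁pos, hσ₁le, hhit, hout⟩ := exists_first_hit (sub_nonneg.2 ht₁₂) hfc hf0 hf1
  set τ : ℝ := t₁ + σ₁ with hτdef
  have ht₁τ : t₁ ≤ τ := by linarith
  have hYτ : ‖Y τ‖ = R₁ := by have := hhit; simp only [hfdef] at this; linarith
  have hfarArc : ∀ s ∈ Icc t₁ τ, R₁ ≤ ‖Y s‖ := by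
    intro s hs
    have := hout (s - t₁) ⟨by linarith [hs.1], by linarith [hs.2]⟩
    simp only [hfdef, add_sub_cancel] at this
    linarith
  -- high and vortical along `[0, τ]`
  have hvort : ∀ s : ℝ, 0 ≤ s → curl V (Y s) ≠ 0 := fun s hs =>
    OutflowDive.vorticityTransport ρ hρ hρh V P' hprof s hs Y (fun σ hσ => hY' σ hσ.1) hcurl0
  -- speed floor on the excursion
  have hspeed : ∀ s ∈ Icc t₁ τ, w₀ ≤ ‖W (Y s)‖ := fun s hs =>
    hnohov (Y s) (hfarArc s hs) (hlow s (ht₁.trans hs.1)) (hvort s (ht₁.trans hs.1))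
  -- displacement ≤ length: `‖Y τ − Y t₁‖ ≤ ∫ ‖W(Y)‖`
  have hderivI : ∀ s ∈ uIcc t₁ τ, HasDerivAt Y ((-1 : ℝ) • W (Y s)) s := by
    intro s hs; rw [uIcc_of_le ht₁τ] at hs; exact hY s (ht₁.trans hs.1)
  have hintW : IntervalIntegrable (fun s => (-1 : ℝ) • W (Y s)) volume t₁ τ :=
    ((hWc.comp_continuousOn (hYc t₁ τ ht₁)).const_smul (-1 : ℝ)).intervalIntegrable_of_Icc ht₁τ
  have hFTC : ∫ s in t₁..τ, (-1 : ℝ) • W (Y s) = Y τ - Y t₁ :=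
    intervalIntegral.integral_eq_sub_of_hasDerivAt hderivI hintW
  have hdisp : L ≤ ∫ s in t₁..τ, ‖W (Y s)‖ := by
    have h1 : ‖Y τ - Y t₁‖ ≤ ∫ s in t₁..τ, ‖(-1 : ℝ) • W (Y s)‖ := by
      rw [← hFTC]; exact intervalIntegral.norm_integral_le_integral_norm ht₁τ
    have h2 : (fun s => ‖(-1 : ℝ) • W (Y s)‖) = fun s => ‖W (Y s)‖ := by
      funext s; rw [neg_one_smul, norm_neg]
    rw [h2] at h1
    have h3 : ‖Y t₁‖ - ‖Y τ‖ ≤ ‖Y τ - Y t₁‖ := by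
      rw [← norm_neg (Y τ - Y t₁), neg_sub]; exact norm_sub_norm_le _ _
    rw [hYτ] at h3
    linarith
  -- action ≥ w₀ · length
  have hintn : IntervalIntegrable (fun s => ‖W (Y s)‖) volume t₁ τ :=
    ((hWc.comp_continuousOn (hYc t₁ τ ht₁)).norm).intervalIntegrable_of_Icc ht₁τ
  have hact_ge : w₀ * L ≤ ∫ s in t₁..τ, ‖W (Y s)‖ ^ 2 := by
    have hpt : ∀ s ∈ Icc t₁ τ, w₀ * ‖W (Y s)‖ ≤ ‖W (Y s)‖ ^ 2 := by
      intro s hs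
      rw [sq]
      exact mul_le_mul_of_nonneg_right (hspeed s hs) (norm_nonneg _)
    have h1 := intervalIntegral.integral_mono_on ht₁τ (hintn.const_mul w₀) (hint t₁ τ ht₁ ht₁τ) hpt
    rw [intervalIntegral.integral_const_mul] at h1
    exact le_trans (mul_le_mul_of_nonneg_left hdisp hw₀.le) h1
  have hfinal := hact_le t₁ τ ht₁ ht₁τ
  have : (1 - 2 * γ) * (w₀ * L) ≤ (1 - 2 * γ) * ∫ s in t₁..τ, ‖W (Y s)‖ ^ 2 :=
    mul_le_mul_of_nonneg_left hact_ge h12γ.le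
  have e : (1 - 2 * γ) * (w₀ * L) = (M - h) + (1 - 2 * γ) * w₀ := by rw [← hL]; ring
  linarith [mul_pos h12γ hw₀]

end LastExit

end Summit.NavierStokesRegularity.NavierStokesRegularity.Theorems.PowerGaugeEulerLiouville

end
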